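import Summits.MatrixMultiplication.MatrixMultiplication.Theses.FidelityWitnesses

/-!
# Ideator-2 sketch — crux `LinearDefectLaw` (stmt-MatrixMultiplication-14039), idea `border-singular-values`
(crux-ideate round 1, ideator k = 2)

First-lemma signatures for the line "border singular values of ⟨n,n,n⟩ / spectral-residual
telescoping", plus the PROVED glue `UnitSlope → LinearDefectLaw` (downward telescoping from the
Cauchy–Schwarz level `r = bR`, no closure / Alder–Strassen fact needed, `bR` never computed).
-/

namespace Summit.MatrixMultiplication.MatrixMultiplication.Cruxes.LinearDefectLaw.Sketch

open scoped BigOperators ComplexConjugate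
open Literature.Computability.AlgebraicComplexity
open Summit.MatrixMultiplication.MatrixMultiplication.Theses.FidelityWitnesses (LinearDefectLaw)

/-- index type of one slot of `⟨n,n,n⟩` -/
abbrev P (n : ℕ) := Fin n × Fin n

/-- bilinear overlap `Σ S·⟨n,n,n⟩` (the crux's numerator, before `‖·‖²`). -/
noncomputable def overlap {n : ℕ} (S : P n → P n → P n → ℂ) : ℂ :=
  ∑ a, ∑ b, ∑ c, S a b c * matMulTensor ℂ n n n a b c

/-- squared Frobenius norm `Σ ‖S_{abc}‖²`. -/
noncomputable def normSq {n : ℕ} (S : P n → P n → P n → ℂ) : ℝ :=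
  ∑ a, ∑ b, ∑ c, ‖S a b c‖ ^ 2

theorem normSq_nonneg {n : ℕ} (S : P n → P n → P n → ℂ) : 0 ≤ normSq S := by
  unfold normSq; positivity

/-! ## Level `r ≥ bR`: Cauchy–Schwarz, `|Σ S·T|² ≤ n³ · Σ‖S‖²` -/

theorem norm_matMulTensor (n : ℕ) (a b c : P n) :
    ‖matMulTensor ℂ n n n a b c‖ = matMulTensor ℝ n n n a b c := by
  simp only [matMulTensor]
  split_ifs <;> simp

theorem sq_matMulTensor_real (n : ℕ) (a b c : P n) :
    matMulTensor ℝ n n n a b c ^ 2 = matMulTensor ℝ n n n a b c := by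
  simp only [matMulTensor]
  split_ifs <;> simp

/-- `Σ_{abc} ⟨n,n,n⟩_{abc} = n³` (number of unit products; the route's `closes` proof, specialised). -/
theorem sum_matMulTensor_real (n : ℕ) :
    (∑ a : P n, ∑ b : P n, ∑ c : P n, matMulTensor ℝ n n n a b c) = (n : ℝ) ^ 3 := by
  have h1 : ∀ a b : P n,
      (∑ c : P n, matMulTensor ℝ n n n a b c) = if a.1 = b.1 then 1 else 0 := by
    intro a b
    by_cases hab : a.1 = b.1
    · rw [if_pos hab, Finset.sum_eq_single (b.2, a.2)]
      · simp [matMulTensor, hab]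
      · intro c _ hc
        simp only [matMulTensor]
        rw [if_neg]
        rintro ⟨-, h2, h3⟩
        exact hc (Prod.ext h2.symm h3.symm)
      · intro h
        exact absurd (Finset.mem_univ _) h
    · rw [if_neg hab]
      exact Finset.sum_eq_zero fun c _ => by
        simp [matMulTensor, hab]
  have h2 : ∀ a : P n, (∑ b : P n, if a.1 = b.1 then (1 : ℝ) else 0) = n := by
    intro a
    rw [Fintype.sum_prod_type, Finset.sum_comm]
    simp
  simp_rw [h1, h2]
  simp [Finset.sum_const, Finset.card_univ, Fintype.card_prod, Fintype.card_fin]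
  ring

/-- **Cauchy–Schwarz at `⟨n,n,n⟩`:** `|Σ S·T|² ≤ n³·Σ‖S‖²` for every `S` (the law at every level
`r ≥ bR`, where its constant is `≥ n³`). [folklore] -/
theorem overlap_sq_le {n : ℕ} (S : P n → P n → P n → ℂ) :
    ‖overlap S‖ ^ 2 ≤ (n : ℝ) ^ 3 * normSq S := by
  -- pointwise bound and flattening of the format to one finite index
  let f : P n × P n × P n → ℝ := fun p => ‖S p.1 p.2.1 p.2.2‖
  let g : P n × P n × P n → ℝ := fun p => matMulTensor ℝ n n n p.1 p.2.1 p.2.2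
  have hle : ‖overlap S‖ ≤ ∑ p, f p * g p := by
    have step : ‖overlap S‖ ≤ ∑ a, ∑ b, ∑ c, ‖S a b c‖ * matMulTensor ℝ n n n a b c := by
      unfold overlap
      refine (norm_sum_le _ _).trans (Finset.sum_le_sum fun a _ => ?_)
      refine (norm_sum_le _ _).trans (Finset.sum_le_sum fun b _ => ?_)
      refine (norm_sum_le _ _).trans (Finset.sum_le_sum fun c _ => ?_)
      rw [norm_mul, norm_matMulTensor]
    simpa only [Fintype.sum_prod_type] using step
  have hf : (∑ p, f p ^ 2) = normSq S := by
    unfold normSq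
    simp only [Fintype.sum_prod_type, f]
  have hg : (∑ p, g p ^ 2) = (n : ℝ) ^ 3 := by
    rw [← sum_matMulTensor_real n]
    simp only [Fintype.sum_prod_type, g, sq_matMulTensor_real]
  have hcs : (∑ p, f p * g p) ^ 2 ≤ (∑ p, f p ^ 2) * ∑ p, g p ^ 2 :=
    Finset.sum_mul_sq_le_sq_mul_sq _ _ _
  rw [hf, hg] at hcs
  calc ‖overlap S‖ ^ 2 ≤ (∑ p, f p * g p) ^ 2 := pow_le_pow_left₀ (norm_nonneg _) hle 2
    _ ≤ normSq S * (n : ℝ) ^ 3 := hcs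
    _ = (n : ℝ) ^ 3 * normSq S := mul_comm _ _

/-! ## The transferred crux `C⁺ = UnitSlope` and the proved glue -/

/-- **`UnitSlope`** ("every border singular value of `⟨n,n,n⟩` is at least one"): below the border
rank, one more (border) multiplication always buys at least one more full unit of overlap — if
`c` bounds `|Σ S'·T|²/Σ‖S'‖²` at rank `r + 1` and `r < bR(⟨n,n,n⟩)`, then `c − 1` bounds it at rank
`r`.  No value of `bR` is ever needed: it enters only through the hypothesis `r < bR`. -/
def UnitSlope : Prop :=
  ∀ (n r : ℕ) (c : ℝ), r < algBorderRank (matMulTensor ℂ n n n) →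
    (∀ S' : P n → P n → P n → ℂ, tensorRank S' ≤ r + 1 → ‖overlap S'‖ ^ 2 ≤ c * normSq S') →
    ∀ S : P n → P n → P n → ℂ, tensorRank S ≤ r → ‖overlap S‖ ^ 2 ≤ (c - 1) * normSq S

/-- **Glue (proved): `UnitSlope → LinearDefectLaw`.**  Telescoping downward from the level
`r = bR`, where the law's constant is `n³` and Cauchy–Schwarz gives it for every tensor. -/
theorem linearDefectLaw_of_unitSlope (h : UnitSlope) : LinearDefectLaw := by
  intro n r S hS
  obtain ⟨b, hb⟩ : ∃ b : ℕ, algBorderRank (matMulTensor ℂ n n n) = b := ⟨_, rfl⟩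
  -- for every `k` and every `r` with `r + k = bR`: constant `n³ − k`
  have main : ∀ k r', r' + k = b → ∀ S₀ : P n → P n → P n → ℂ, tensorRank S₀ ≤ r' →
      ‖overlap S₀‖ ^ 2 ≤ ((n : ℝ) ^ 3 - k) * normSq S₀ := by
    intro k
    induction k with
    | zero =>
      intro r' _ S₀ _
      simpa using overlap_sq_le S₀
    | succ k ih =>
      intro r' hr' S₀ hS₀
      have hlt : r' < algBorderRank (matMulTensor ℂ n n n) := by rw [hb]; omega
      have hyp : ∀ S' : P n → P n → P n → ℂ, tensorRank S' ≤ r' + 1 →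
          ‖overlap S'‖ ^ 2 ≤ ((n : ℝ) ^ 3 - k) * normSq S' := ih (r' + 1) (by omega)
      have key := h n r' ((n : ℝ) ^ 3 - k) hlt hyp S₀ hS₀
      have e : (n : ℝ) ^ 3 - (k : ℝ) - 1 = (n : ℝ) ^ 3 - ((k + 1 : ℕ) : ℝ) := by
        push_cast; ring
      rw [e] at key
      exact key
  have goal : ‖overlap S‖ ^ 2 ≤ ((n : ℝ) ^ 3 + (r : ℝ) - (b : ℝ)) * normSq S := by
    by_cases hrb : r ≤ b
    · obtain ⟨k, hk⟩ : ∃ k, r + k = b := ⟨b - r, by omega⟩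
      have hcast : (n : ℝ) ^ 3 + (r : ℝ) - (b : ℝ) = (n : ℝ) ^ 3 - (k : ℝ) := by
        have : (b : ℝ) = (r : ℝ) + (k : ℝ) := by exact_mod_cast hk.symm
        rw [this]; ring
      rw [hcast]
      exact main k r hk S hS
    · have hbr : (b : ℝ) ≤ (r : ℝ) := by exact_mod_cast (Nat.lt_of_not_le hrb).le
      calc ‖overlap S‖ ^ 2 ≤ (n : ℝ) ^ 3 * normSq S := overlap_sq_le S
        _ ≤ ((n : ℝ) ^ 3 + (r : ℝ) - (b : ℝ)) * normSq S := by
          apply mul_le_mul_of_nonneg_right _ (normSq_nonneg S)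
          linarith
  rw [hb]
  simpa only [overlap, normSq] using goal

/-! ## The mechanism: spectral norm of the nearest-point residual -/

/-- residual of `T = ⟨n,n,n⟩` after orthogonal projection onto the complex line `ℂ·S`:
`E_S = T − (⟨S,T⟩/⟨S,S⟩)·S` with `⟨S,T⟩ = Σ conj(S)·T = conj(overlap S)` (`T` is real). -/
noncomputable def resid {n : ℕ} (S : P n → P n → P n → ℂ) : P n → P n → P n → ℂ :=
  fun a b c => matMulTensor ℂ n n n a b c - (conj (overlap S) / (normSq S : ℂ)) * S a b c

/-- trilinear evaluation `E(x,y,z) = Σ E_{abc} x_a y_b z_c`; `sup` of `|E(x,y,z)|` over unit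
`x, y, z` is the spectral (injective) norm `‖E‖_σ`. -/
noncomputable def triEval {n : ℕ} (E : P n → P n → P n → ℂ) (x y z : P n → ℂ) : ℂ :=
  ∑ a, ∑ b, ∑ c, E a b c * x a * y b * z c

/-- unit vector in one slot -/
def IsUnitVec {n : ℕ} (x : P n → ℂ) : Prop := ∑ i, ‖x i‖ ^ 2 = 1

/-- fidelity numerator `|Σ S·T|² / Σ‖S‖²` (`= ‖P_{ℂS} T‖²`; junk `0` at `S = 0`). -/
noncomputable def fid {n : ℕ} (S : P n → P n → P n → ℂ) : ℝ := ‖overlap S‖ ^ 2 / normSq S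

/-- **`OneStepGain`** (support, provable now — two-dimensional Bessel): projecting `T` onto
`span(S, x̄⊗ȳ⊗z̄)` instead of `ℂ·S` gains at least `|E_S(x,y,z)|²`, and the projection has rank
`≤ r + 1`.  This is the tensor shadow of `‖P − P_{(k)}‖_op = σ_{k+1}(P)` for matrices. -/
def OneStepGain : Prop :=
  ∀ (n r : ℕ) (S : P n → P n → P n → ℂ) (x y z : P n → ℂ), tensorRank S ≤ r → S ≠ 0 →
    IsUnitVec x → IsUnitVec y → IsUnitVec z →
    ∃ S' : P n → P n → P n → ℂ, tensorRank S' ≤ r + 1 ∧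
      fid S + ‖triEval (resid S) x y z‖ ^ 2 ≤ fid S'

/-- **`SpectralResidual`** (the content of the line, `δ`-optimal form so that border suprema are
covered): below the border rank, every near-optimal rank-`≤ r` approximant of `⟨n,n,n⟩` leaves a
residual whose spectral norm is at least `1` — "what is still missing always contains one whole
unit triad".  Equality at the partial-matrix-multiplication optima (`(2,1),(2,2),(2,5),(2,6)`). -/
def SpectralResidual : Prop :=
  ∀ (n r : ℕ), r < algBorderRank (matMulTensor ℂ n n n) → ∀ ε : ℝ, 0 < ε → ∃ δ : ℝ, 0 < δ ∧
    ∀ S : P n → P n → P n → ℂ, tensorRank S ≤ r → S ≠ 0 →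
      (∀ S' : P n → P n → P n → ℂ, tensorRank S' ≤ r → fid S' ≤ fid S + δ) →
      ∃ x y z : P n → ℂ, IsUnitVec x ∧ IsUnitVec y ∧ IsUnitVec z ∧
        1 - ε ≤ ‖triEval (resid S) x y z‖ ^ 2

/-- Shape of the line: `OneStepGain → SpectralResidual → UnitSlope (→ LinearDefectLaw)`;
the first arrow is a `sup` bookkeeping over near-optimal `S`, the last is
`linearDefectLaw_of_unitSlope`. -/
def LineShape : Prop := OneStepGain → SpectralResidual → UnitSlope

/-- **`FreeRotatedProduct n r`** (menu form "OM" of the mechanism): every sum of `r` triads is ORTHOGONAL to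
some rotated unit product `(p⊗q) ⊗ (p̄⊗s) ⊗ (s̄⊗q̄)` of `⟨n,n,n⟩` — a spectral maximiser of `T`
(`⟨T, ·⟩ = 1` after normalisation), in the tree's slot convention `a = (κ,ν)`, `b = (κ,μ)`, `c = (μ,ν)`.
Where it holds, adding that product to `S` gains a full unit with no spectral computation, so
`UnitSlope` holds at level `r`.  PROVABLE NOW for `r ≤ 2n − 2` (choose `q`; `p` in the kernel of the
`≤ n − 1` forms `p ↦ pᵀŪ_l q`, `l ∈ L₁`; `s` in the kernel of the remaining `≤ n − 1` forms): the first
rungs of `UnitSlope` are unconditional. -/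
def FreeRotatedProduct (n r : ℕ) : Prop :=
  ∀ (u v w : Fin r → P n → ℂ), ∃ p q s : Fin n → ℂ, p ≠ 0 ∧ q ≠ 0 ∧ s ≠ 0 ∧
    (∑ a : P n, ∑ b : P n, ∑ c : P n, conj ((∑ l, triad (u l) (v l) (w l)) a b c) *
      ((p a.1 * q a.2) * (conj (p b.1) * s b.2) * (conj (s c.1) * conj (q c.2)))) = 0

/-- the unconditional first rungs (support statement, provable now by kernel-dimension counting). -/
def FreeRotatedProductSmall : Prop := ∀ n r : ℕ, r + 2 ≤ 2 * n → FreeRotatedProduct n r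

end Summit.MatrixMultiplication.MatrixMultiplication.Cruxes.LinearDefectLaw.Sketch
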